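import Literature.Barriers.QuantumFields.EguchiKawaiBreakdownSpecialUnitary
import Summits.Ventures.YMGap.Thresholds.LatticeBakryEmeryLipschitz
import Summits.Ventures.YMGap.Thresholds.LatticeBakryEmeryWilson
import HarnessLib

/-!
# The Eguchi–Kawai reduced action and open lines on the ambient algebra `(Fin d → M_N(ℂ))`

HONEST FRAMING. Glue for LINE 8 (`route-QuantumFields-EguchiKawaiDirectionLadder`, the barrier-ledger
line onto `Literature.Barriers.QuantumFields.EguchiKawaiBreakdown`), serving the STRONG-COUPLING
companion of the proved breakdown — evasion (d) of the barrier entry («no such breaking occurs within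
the strong-coupling expansion», Makeenko 2023 §14.3, p. 246) made a theorem about the single-site
integral via the tree's multi-link Bakry–Émery engine. Nothing here concerns the Yang–Mills mass gap /
the summit Statement `YangMills`.

This is the first half of the ADAPTER between w4's `SU(N)` single-site model
(`Literature.Barriers.QuantumFields.ekHaarSU / ekExpectationSU / ekWeight ∘ inclSU`,
`EguchiKawaiBreakdownSpecialUnitary.lean`) and the kernel-checked **multi-link Bakry–Émery Poincaré
inequality on `SU(N)^E` for polynomial potentials**
(`Summit.Ventures.YMGap.LatticeBakryEmery.poincare_gibbs_lipschitz`, venture YMGap): the objects.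

* `ekPlaq μ ν`, `ekPot d N b` : the reduced plaquette `Re tr(Q_νᴴ Q_μᴴ Q_ν Q_μ)` and the potential
  `-N² b S_R[Q]` (Makeenko (14.38)–(14.40)) on the ambient algebra `Cfg (Fin d) N = (Fin d → M_N(ℂ))`,
  written so that `exp (ekPot (emb g)) = ekWeight N b (inclSU g)` and `haarPi (Fin d) N = ekHaarSU d N`
  hold BY `rfl` (`exp_ekPot_emb`, `haarPi_eq_ekHaarSU`);
* `ekPot_mem_polySpace` : the potential is a real polynomial of degree `≤ 4` in the link entries
  (via `LatticeBakryEmeryWilson`'s `IsCPolyMat`), hence smooth; `ekTerm` its off-diagonal summand;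
* `ekReLink μ / ekImLink μ` : `Re/Im tr(Q_μ)/N`, equal on `SU(N)^d` to the real/imaginary parts of the
  open line `openLine μ` (`ekReLink_emb`), smooth, and **`1/√N`-Lipschitz in the link `μ`**, constant
  in the others (`linkLipschitz_ekReLink/_ekImLink`, from `‖tr A‖ ≤ √N ‖A‖_F`); `Σ_e L_e² = 1/N`.

The Hessian bound `HessBound (ekPot d N b) (8(d-1)N|b|)` and the resulting Poincaré inequalities are in
`EguchiKawaiDirectionLadderReducedActionHessian.lean`.

References: Y. Makeenko, *Methods of Contemporary Gauge Theory* (2023) §14.3 (14.38)–(14.41), (14.48);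
H. Shen, R. Zhu, X. Zhu, CMP 400 (2023) 805, §4.1 (the lattice analogue).
-/


noncomputable section

open scoped Matrix ComplexConjugate BigOperators Matrix.Norms.Frobenius ContDiff Topology
open Matrix Complex Finset MeasureTheory Filter
open Summit.Ventures.YMGap.LatticeBakryEmery
open Literature.MathematicalPhysics.QuantumFieldTheory (frobNorm frobNorm_nonneg frobNorm_sq_eq_re_trace
  frobNorm_smul suFrobDist haarProbability)
open Literature.Barriers.QuantumFields (EKConfigSU ekHaarSU inclSU ekWeight ekAction ekPlaqTrace openLine
  coe_inclSU_apply)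

namespace Summit.QuantumFields.YangMills.Theorems.EguchiKawaiDirectionLadder

variable {d N : ℕ}

/-! ## The reduced action on the ambient algebra -/

/-- One reduced plaquette `Re tr(Q_νᴴ Q_μᴴ Q_ν Q_μ)` as a function on the ambient algebra
`(Fin d → M_N(ℂ))` (Makeenko (14.38): `tr U_ν† U_μ† U_ν U_μ`). -/
def ekPlaq (μ ν : Fin d) : Cfg (Fin d) N → ℝ := fun Q => ((Q ν)ᴴ * (Q μ)ᴴ * Q ν * Q μ).trace.re

variable (d N) in
/-- **The Eguchi–Kawai potential** `-N² b S_R[Q] = -N² b Σ_{μ≠ν} (1 - Re tr(Q_νᴴ Q_μᴴ Q_ν Q_μ)/N)/2`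
on the ambient algebra — written so that `exp (ekPot (emb g))` is literally the Boltzmann weight
`ekWeight N b (inclSU g)` of the `SU(N)` single-site model. -/
def ekPot (b : ℝ) : Cfg (Fin d) N → ℝ := fun Q =>
  -((N : ℝ) ^ 2 * b) * ∑ μ : Fin d, ∑ ν : Fin d, if μ = ν then 0 else (1 - ekPlaq μ ν Q / N) / 2

/-- On `SU(N)^d` the potential is `-N² b` times the reduced action of the included configuration. -/
theorem ekPot_emb (b : ℝ) (g : PSU (Fin d) N) :
    ekPot d N b (emb g) = -((N : ℝ) ^ 2 * b) * ekAction (inclSU g) := by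
  rfl

/-- **`exp (ekPot (emb g)) = ekWeight N b (inclSU g)`**. -/
theorem exp_ekPot_emb (b : ℝ) (g : PSU (Fin d) N) :
    Real.exp (ekPot d N b (emb g)) = ekWeight N b (inclSU g) := by
  rfl

/-- The product Haar measure of the multi-link engine IS the a-priori measure of the `SU(N)` model. -/
theorem haarPi_eq_ekHaarSU : haarPi (Fin d) N = ekHaarSU d N := rfl

/-! ## Polynomiality -/

/-- Each reduced plaquette is a real polynomial of degree `≤ 4` in the link entries. -/
theorem ekPlaq_mem_polySpace (μ ν : Fin d) : ekPlaq (N := N) μ ν ∈ polySpace (Fin d) N 4 := by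
  have h : IsCPolyMat (ι := Fin d) (N := N) (1 + 1 + 1 + 1) fun Q => (Q ν)ᴴ * (Q μ)ᴴ * Q ν * Q μ :=
    (((isCPolyMat_link ν).conjTranspose.mul (isCPolyMat_link μ).conjTranspose).mul
      (isCPolyMat_link ν)).mul (isCPolyMat_link μ)
  exact h.re_trace_mem

/-- Each reduced plaquette is smooth. -/
theorem contDiff_ekPlaq (μ ν : Fin d) : ContDiff ℝ ∞ (ekPlaq (N := N) μ ν) :=
  contDiff_of_mem_polySpace (ekPlaq_mem_polySpace μ ν)

/-- The off-diagonal summand `[μ ≠ ν] (1 - Re tr(…)/N)/2` as a function. -/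
theorem ite_term_eq (μ ν : Fin d) :
    (fun Q : Cfg (Fin d) N => if μ = ν then (0 : ℝ) else (1 - ekPlaq μ ν Q / N) / 2) =
      if μ = ν then (fun _ => (0 : ℝ)) else fun Q => (1 - ekPlaq μ ν Q / N) / 2 := by
  funext Q; split_ifs <;> rfl

/-- The off-diagonal summands are polynomials of degree `≤ 4`. -/
theorem ite_term_mem_polySpace (μ ν : Fin d) :
    (fun Q : Cfg (Fin d) N => if μ = ν then (0 : ℝ) else (1 - ekPlaq μ ν Q / N) / 2) ∈
      polySpace (Fin d) N 4 := by
  rw [ite_term_eq]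
  split_ifs
  · exact Submodule.zero_mem _
  · have h1 : (fun Q : Cfg (Fin d) N => (1 - ekPlaq μ ν Q / N) / 2) =
        (fun _ => (1 / 2 : ℝ)) - (1 / (2 * (N : ℝ))) • ekPlaq (N := N) μ ν := by
      funext Q; simp only [Pi.sub_apply, Pi.smul_apply, smul_eq_mul]; ring
    rw [h1]
    exact Submodule.sub_mem _ (const_mem_polySpace _ _) (Submodule.smul_mem _ _ (ekPlaq_mem_polySpace μ ν))

/-- **The Eguchi–Kawai potential is a real polynomial of degree `≤ 4`** in the link entries. -/
theorem ekPot_mem_polySpace (b : ℝ) : ekPot d N b ∈ polySpace (Fin d) N 4 := by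
  have h : ekPot d N b = (-((N : ℝ) ^ 2 * b)) • ∑ μ : Fin d, ∑ ν : Fin d,
      fun Q : Cfg (Fin d) N => if μ = ν then (0 : ℝ) else (1 - ekPlaq μ ν Q / N) / 2 := by
    funext Q; simp only [ekPot, Pi.smul_apply, Finset.sum_apply, smul_eq_mul]
  rw [h]
  exact Submodule.smul_mem _ _ (Submodule.sum_mem _ fun μ _ => Submodule.sum_mem _ fun ν _ =>
    ite_term_mem_polySpace μ ν)

/-- The potential is smooth. -/
theorem contDiff_ekPot (b : ℝ) : ContDiff ℝ ∞ (ekPot d N b) :=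
  contDiff_of_mem_polySpace (ekPot_mem_polySpace b)


/-! ## The Hessian of the potential -/

/-- The off-diagonal summand of the potential, as a named function. -/
def ekTerm (μ ν : Fin d) : Cfg (Fin d) N → ℝ := fun Q => if μ = ν then 0 else (1 - ekPlaq μ ν Q / N) / 2

/-- `ekPot = -N²b · Σ_μ Σ_ν ekTerm μ ν`. -/
theorem ekPot_eq (b : ℝ) :
    ekPot d N b = fun Q => -((N : ℝ) ^ 2 * b) * ∑ μ : Fin d, ∑ ν : Fin d, ekTerm μ ν Q := rfl

/-- The summands are smooth. -/
theorem contDiff_ekTerm (μ ν : Fin d) : ContDiff ℝ ∞ (ekTerm (N := N) μ ν) :=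
  contDiff_of_mem_polySpace (ite_term_mem_polySpace μ ν)

/-! ## The open-line observables and their Lipschitz constants -/

/-- `Re tr(Q_μ)/N` on the ambient algebra. -/
def ekReLink (μ : Fin d) : Cfg (Fin d) N → ℝ := fun Q => (Q μ).trace.re / N

/-- `Im tr(Q_μ)/N` on the ambient algebra. -/
def ekImLink (μ : Fin d) : Cfg (Fin d) N → ℝ := fun Q => (Q μ).trace.im / N

/-- On `SU(N)^d`, `ekReLink μ` is the real part of the open line `(1/N) tr V_μ`. -/
theorem ekReLink_emb (μ : Fin d) (g : PSU (Fin d) N) :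
    ekReLink μ (emb g) = (openLine μ (inclSU g)).re := by
  simp [ekReLink, openLine, Complex.div_natCast_re]

/-- On `SU(N)^d`, `ekImLink μ` is the imaginary part of the open line `(1/N) tr V_μ`. -/
theorem ekImLink_emb (μ : Fin d) (g : PSU (Fin d) N) :
    ekImLink μ (emb g) = (openLine μ (inclSU g)).im := by
  simp [ekImLink, openLine, Complex.div_natCast_im]

/-- `ekReLink μ` is smooth (a linear function). -/
theorem contDiff_ekReLink (μ : Fin d) : ContDiff ℝ ∞ (ekReLink (N := N) μ) := by
  have h := (contDiff_pReTrMul (ι := Fin d) (N := N) μ 1).div_const (N : ℝ)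
  have e : (fun Q : Cfg (Fin d) N => (Q μ * (1 : Matrix (Fin N) (Fin N) ℂ)).trace.re / N) = ekReLink μ := by
    funext Q; simp [ekReLink]
  rwa [e] at h

/-- `ekImLink μ` is smooth (a linear function: `Im tr Q = Re tr(Q · (-i))`). -/
theorem contDiff_ekImLink (μ : Fin d) : ContDiff ℝ ∞ (ekImLink (N := N) μ) := by
  have h := (contDiff_pReTrMul (ι := Fin d) (N := N) μ ((-I) • (1 : Matrix (Fin N) (Fin N) ℂ))).div_const (N : ℝ)
  have e : (fun Q : Cfg (Fin d) N => (Q μ * ((-I) • (1 : Matrix (Fin N) (Fin N) ℂ))).trace.re / N) = ekImLink μ := by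
    funext Q
    simp [ekImLink, Matrix.trace_smul, Complex.mul_re]
  rwa [e] at h

/-- `‖tr A‖ ≤ √N ‖A‖_F` (Cauchy–Schwarz on the diagonal). -/
theorem norm_trace_le_sqrt_mul_frobNorm (A : Matrix (Fin N) (Fin N) ℂ) :
    ‖A.trace‖ ≤ Real.sqrt N * frobNorm A := by
  have h1 : ‖A.trace‖ ≤ ∑ i, ‖A i i‖ := by
    rw [Matrix.trace]; exact norm_sum_le _ _
  have hcs := Finset.sum_mul_sq_le_sq_mul_sq (Finset.univ : Finset (Fin N)) (fun _ => (1 : ℝ)) (fun i => ‖A i i‖)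
  simp only [one_pow, Finset.sum_const, Finset.card_univ, Fintype.card_fin, nsmul_eq_mul, mul_one, one_mul] at hcs
  have h2 : ∑ i, ‖A i i‖ ^ 2 ≤ frobNorm A ^ 2 := by
    rw [Literature.MathematicalPhysics.QuantumFieldTheory.frobNorm_sq]
    exact Finset.sum_le_sum fun i _ =>
      Finset.single_le_sum (f := fun j => ‖A i j‖ ^ 2) (fun _ _ => sq_nonneg _) (Finset.mem_univ i)
  have h3 : (∑ i, ‖A i i‖) ^ 2 ≤ (Real.sqrt N * frobNorm A) ^ 2 := by
    rw [mul_pow, Real.sq_sqrt (Nat.cast_nonneg N)]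
    exact hcs.trans (mul_le_mul_of_nonneg_left h2 (Nat.cast_nonneg N))
  have h4 : ∑ i, ‖A i i‖ ≤ Real.sqrt N * frobNorm A :=
    (pow_le_pow_iff_left₀ (Finset.sum_nonneg fun i _ => norm_nonneg _)
      (mul_nonneg (Real.sqrt_nonneg _) (frobNorm_nonneg _)) two_ne_zero).1 h3
  exact h1.trans h4


/-- The open-line observables depend on the link `μ` only. -/
theorem ekReLink_eq_of_eq (μ : Fin d) {g h : PSU (Fin d) N} (hμ : g μ = h μ) :
    ekReLink μ (emb g) = ekReLink μ (emb h) := by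
  simp [ekReLink, hμ]

/-- The open-line observables depend on the link `μ` only. -/
theorem ekImLink_eq_of_eq (μ : Fin d) {g h : PSU (Fin d) N} (hμ : g μ = h μ) :
    ekImLink μ (emb g) = ekImLink μ (emb h) := by
  simp [ekImLink, hμ]

/-- `|x/N - y/N| ≤ (1/√N) ‖A - B‖_F` whenever `|x - y| ≤ ‖tr(A - B)‖` — the common step of the two
Lipschitz estimates. -/
theorem abs_div_sub_div_le {x y : ℝ} {A B : Matrix (Fin N) (Fin N) ℂ} (hxy : |x - y| ≤ ‖(A - B).trace‖) :
    |x / N - y / N| ≤ 1 / Real.sqrt N * frobNorm (A - B) := by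
  rcases Nat.eq_zero_or_pos N with hN | hN
  · subst hN; simp
  have hNr : (0 : ℝ) < N := by exact_mod_cast hN
  rw [← sub_div, abs_div, abs_of_pos hNr]
  have h := hxy.trans (norm_trace_le_sqrt_mul_frobNorm (A - B))
  calc |x - y| / N ≤ Real.sqrt N * frobNorm (A - B) / N := div_le_div_of_nonneg_right h hNr.le
    _ = 1 / Real.sqrt N * frobNorm (A - B) := by rw [mul_div_right_comm, Real.sqrt_div_self']

/-- **`Re tr(Q_μ)/N` is `1/√N`-Lipschitz in the link `μ`** (and constant in the other links). -/
theorem linkLipschitz_ekReLink (μ : Fin d) :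
    LinkLipschitz (ekReLink (N := N) μ) (fun e => if e = μ then 1 / Real.sqrt N else 0) := by
  intro e g h hgh
  by_cases he : e = μ
  · subst he
    simp only [if_true, ekReLink, emb_apply, suFrobDist]
    exact abs_div_sub_div_le (by rw [← Complex.sub_re, ← Matrix.trace_sub]; exact Complex.abs_re_le_norm _)
  · have hμ : g μ = h μ := hgh μ (Ne.symm he)
    rw [ekReLink_eq_of_eq μ hμ, sub_self, abs_zero]
    simp [he]

/-- **`Im tr(Q_μ)/N` is `1/√N`-Lipschitz in the link `μ`** (and constant in the other links). -/
theorem linkLipschitz_ekImLink (μ : Fin d) :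
    LinkLipschitz (ekImLink (N := N) μ) (fun e => if e = μ then 1 / Real.sqrt N else 0) := by
  intro e g h hgh
  by_cases he : e = μ
  · subst he
    simp only [if_true, ekImLink, emb_apply, suFrobDist]
    exact abs_div_sub_div_le (by rw [← Complex.sub_im, ← Matrix.trace_sub]; exact Complex.abs_im_le_norm _)
  · have hμ : g μ = h μ := hgh μ (Ne.symm he)
    rw [ekImLink_eq_of_eq μ hμ, sub_self, abs_zero]
    simp [he]

/-- `Σ_e L_e² = 1/N` for the Lipschitz profile `L = 1/√N · 𝟙_{e = μ}`. -/
theorem sum_sq_linkLip (μ : Fin d) :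
    ∑ e : Fin d, (if e = μ then 1 / Real.sqrt N else (0 : ℝ)) ^ 2 = 1 / N := by
  have h : ∀ e : Fin d, (if e = μ then 1 / Real.sqrt N else (0 : ℝ)) ^ 2 =
      if e = μ then (1 / (N : ℝ)) else 0 := by
    intro e
    split_ifs
    · rw [one_div, inv_pow, Real.sq_sqrt (Nat.cast_nonneg N), one_div]
    · simp
  simp only [h, Finset.sum_ite_eq', Finset.mem_univ, if_true]

end Summit.QuantumFields.YangMills.Theorems.EguchiKawaiDirectionLadder
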